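import Mathlib
import Summits.Ventures.PercRepro2.ThreePointConn

/-!
# Iterated BK: the packing number of an increasing event, and the a = 1 rows of the BAL family
for the max-flow of every finite graph (seat mine-b, cell pub-perc-repro2)

For an increasing event `A` on edge sets, `kDisj A k S` says that `S` contains `k` pairwise disjoint
witnesses of `A` (the `k`-fold disjoint occurrence `A^{∘k}`; `kDisj A 0 = True`,
`kDisj A (k+1) = DOcc A (kDisj A k)`).  The BK inequality of the cell (`bk_weighted`) gives at once
`P(A^{∘(k+1)}) ≤ P(A) · P(A^{∘k})` and hence `P(A^{∘k}) ≤ P(A)^k` for every product measure.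

For `A = {s ↔ t}` the `k`-fold disjoint occurrence is the event `F ≥ k` that the open graph carries
`k` pairwise edge-disjoint `s–t` paths (the max-flow of row B2 of conjectures/MINE-B.md); the
inequalities are the `a = 1` members `P(F ≥ 0)·P(F ≥ b+1) ≤ P(F ≥ 1)·P(F ≥ b)` of the BAL family
(`T(a−1, b+1) ≤ T(a, b)`) for EVERY finite multigraph — the only members of B2/BAL that are classical.
Main results: `flowEvent_succ_le` and `flowEvent_le_pow`.
-/

open Finset

namespace Summit.Ventures.PercRepro2

section Abstract

variable {E : Type*} [Fintype E] [DecidableEq E]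

/-- `k`-fold disjoint occurrence of an event on edge sets: `S` contains `k` pairwise disjoint
witnesses of `A` (`k = 0`: always). -/
def kDisj (A : Finset E → Prop) : ℕ → Finset E → Prop
  | 0 => fun _ => True
  | k + 1 => ReimerCube.DOcc A (kDisj A k)

omit [Fintype E] [DecidableEq E] in
/-- disjoint occurrence is increasing in the configuration, whatever the events -/
lemma incr_dOcc (A B : Finset E → Prop) : ReimerCube.Incr (ReimerCube.DOcc A B) := by
  intro S T hST h
  obtain ⟨K, L, hK, hL, hKL, hA, hB⟩ := h
  exact ⟨K, L, hK.trans hST, hL.trans hST, hKL, hA, hB⟩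

omit [Fintype E] [DecidableEq E] in
/-- `kDisj A k` is increasing -/
lemma incr_kDisj (A : Finset E → Prop) : ∀ k, ReimerCube.Incr (kDisj A k)
  | 0 => fun _ _ _ _ => trivial
  | k + 1 => incr_dOcc A (kDisj A k)

omit [Fintype E] [DecidableEq E] in
/-- one disjoint witness is just the event, for increasing `A` -/
lemma kDisj_one_iff {A : Finset E → Prop} (hA : ReimerCube.Incr A) (S : Finset E) :
    kDisj A 1 S ↔ A S := by
  constructor
  · rintro ⟨K, L, hK, _, _, hAK, _⟩
    exact hAK S hK
  · intro h
    exact ⟨S, ∅, le_rfl, Finset.empty_subset _, Finset.disjoint_empty_right _,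
      fun T hT => hA hT h, fun _ _ => trivial⟩

open Classical in
/-- **Iterated BK, one step**: `P(A^{∘(k+1)}) ≤ P(A) · P(A^{∘k})` for product weights. -/
theorem kDisj_succ_le (p : E → ℝ) (hp : ∀ i, 0 ≤ p i ∧ p i ≤ 1) (A : Finset E → Prop)
    (hA : ReimerCube.Incr A) (k : ℕ) :
    (∑ S ∈ Finset.univ.powerset.filter (kDisj A (k + 1)), ReimerCube.wt Finset.univ p S)
      ≤ (∑ S ∈ Finset.univ.powerset.filter A, ReimerCube.wt Finset.univ p S)
        * (∑ S ∈ Finset.univ.powerset.filter (kDisj A k), ReimerCube.wt Finset.univ p S) :=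
  bk_weighted p hp A (kDisj A k) hA (incr_kDisj A k)

open Classical in
/-- the weighted sums are nonnegative -/
lemma sum_wt_nonneg (p : E → ℝ) (hp : ∀ i, 0 ≤ p i ∧ p i ≤ 1) (A : Finset E → Prop) :
    0 ≤ ∑ S ∈ Finset.univ.powerset.filter A, ReimerCube.wt Finset.univ p S := by
  apply Finset.sum_nonneg
  intro S _
  unfold ReimerCube.wt
  apply Finset.prod_nonneg
  intro e _
  split_ifs
  · exact (hp e).1
  · linarith [(hp e).2]

open Classical in
/-- **Iterated BK**: `P(A^{∘k}) ≤ P(A)^k`. -/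
theorem kDisj_le_pow (p : E → ℝ) (hp : ∀ i, 0 ≤ p i ∧ p i ≤ 1) (A : Finset E → Prop)
    (hA : ReimerCube.Incr A) : ∀ k : ℕ,
    (∑ S ∈ Finset.univ.powerset.filter (kDisj A k), ReimerCube.wt Finset.univ p S)
      ≤ (∑ S ∈ Finset.univ.powerset.filter A, ReimerCube.wt Finset.univ p S) ^ k
  | 0 => by
      simp only [pow_zero]
      have h : Finset.univ.powerset.filter (kDisj A 0) = Finset.univ.powerset := by
        ext S; simp [kDisj]
      rw [h, ReimerCube.sum_wt]
  | k + 1 => by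
      calc (∑ S ∈ Finset.univ.powerset.filter (kDisj A (k + 1)), ReimerCube.wt Finset.univ p S)
          ≤ (∑ S ∈ Finset.univ.powerset.filter A, ReimerCube.wt Finset.univ p S)
            * (∑ S ∈ Finset.univ.powerset.filter (kDisj A k), ReimerCube.wt Finset.univ p S) :=
            kDisj_succ_le p hp A hA k
        _ ≤ (∑ S ∈ Finset.univ.powerset.filter A, ReimerCube.wt Finset.univ p S)
            * (∑ S ∈ Finset.univ.powerset.filter A, ReimerCube.wt Finset.univ p S) ^ k := by
            apply mul_le_mul_of_nonneg_left (kDisj_le_pow p hp A hA k) (sum_wt_nonneg p hp A)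
        _ = (∑ S ∈ Finset.univ.powerset.filter A, ReimerCube.wt Finset.univ p S) ^ (k + 1) := by
            ring

end Abstract

section Flow

variable {V : Type*} {E : Type*} [Fintype E] [DecidableEq E]

/-- **The event `F ≥ k`**: the open edges contain `k` pairwise disjoint sets each of which carries
`s` to `t`, i.e. `k` pairwise edge-disjoint open `s–t` paths (the max-flow is at least `k`). -/
def flowEvent (ends : E → Sym2 V) (s t : V) (k : ℕ) : Set (Config E) :=
  {ω | kDisj (fun S => Carries ends S s t) k (openSet ω)}

/-- `F ≥ 1` is the connection event -/
theorem flowEvent_one (ends : E → Sym2 V) (s t : V) :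
    flowEvent ends s t 1 = connEvent ends s t := by
  ext ω
  simp only [flowEvent, Set.mem_setOf_eq, connEvent]
  rw [kDisj_one_iff (incr_carries ends s t)]
  unfold Carries
  rw [ofFinset_openSet]

/-- `F ≥ 0` always -/
theorem flowEvent_zero (ends : E → Sym2 V) (s t : V) : flowEvent ends s t 0 = Set.univ := by
  ext ω; simp [flowEvent, kDisj]

open Classical in
/-- the probability of `F ≥ k` as a weighted sum over edge sets -/
lemma prob_flowEvent (p : E → ℝ) (ends : E → Sym2 V) (s t : V) (k : ℕ) :
    prob p (flowEvent ends s t k)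
      = ∑ S ∈ Finset.univ.powerset.filter (kDisj (fun S => Carries ends S s t) k),
          ReimerCube.wt Finset.univ p S := by
  rw [prob_eq_sum_wt]
  apply sum_filter_congr_pred
  intro S
  simp only [flowEvent, Set.mem_setOf_eq, openSet_ofFinset]

/-- **The `a = 1` rows of the BAL family for the max-flow of every finite multigraph** (iterated BK):
`P(F ≥ k+1) ≤ P(F ≥ 1) · P(F ≥ k)`, i.e. `P(F ≥ 0)·P(F ≥ k+1) ≤ P(F ≥ 1)·P(F ≥ k)`. -/
theorem flowEvent_succ_le (p : E → ℝ) (hp : IsProbVec p) (ends : E → Sym2 V) (s t : V) (k : ℕ) :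
    prob p (flowEvent ends s t (k + 1)) ≤ prob p (flowEvent ends s t 1) * prob p (flowEvent ends s t k) := by
  have hp' : ∀ i, 0 ≤ p i ∧ p i ≤ 1 := fun i => ⟨hp.nonneg i, hp.le_one i⟩
  classical
  rw [prob_flowEvent, prob_flowEvent, prob_flowEvent]
  have h1 : (∑ S ∈ Finset.univ.powerset.filter (kDisj (fun S => Carries ends S s t) 1),
      ReimerCube.wt Finset.univ p S)
      = ∑ S ∈ Finset.univ.powerset.filter (fun S => Carries ends S s t), ReimerCube.wt Finset.univ p S := by
    apply sum_filter_congr_pred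
    intro S
    exact kDisj_one_iff (incr_carries ends s t) S
  rw [h1]
  exact kDisj_succ_le p hp' _ (incr_carries ends s t) k

/-- **`P(F ≥ k) ≤ P(s ↔ t)^k`** for every finite multigraph and product measure. -/
theorem flowEvent_le_pow (p : E → ℝ) (hp : IsProbVec p) (ends : E → Sym2 V) (s t : V) (k : ℕ) :
    prob p (flowEvent ends s t k) ≤ prob p (connEvent ends s t) ^ k := by
  have hp' : ∀ i, 0 ≤ p i ∧ p i ≤ 1 := fun i => ⟨hp.nonneg i, hp.le_one i⟩
  classical
  rw [← flowEvent_one, prob_flowEvent, prob_flowEvent]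
  have h1 : (∑ S ∈ Finset.univ.powerset.filter (kDisj (fun S => Carries ends S s t) 1),
      ReimerCube.wt Finset.univ p S)
      = ∑ S ∈ Finset.univ.powerset.filter (fun S => Carries ends S s t), ReimerCube.wt Finset.univ p S := by
    apply sum_filter_congr_pred
    intro S
    exact kDisj_one_iff (incr_carries ends s t) S
  rw [h1]
  exact kDisj_le_pow p hp' _ (incr_carries ends s t) k

end Flow

end Summit.Ventures.PercRepro2
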